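import Summits.QuantumFields.BalabanUV.T4Continuum.Support.B13KPStepTermMeasurable
import Summits.QuantumFields.BalabanUV.T4Continuum.Support.NE9RecordIneq126Chain

/-!
# NE5 ∕ U3, route P2 — route P2's END on Bałaban's carriers of record RE-SOCKETED ON THE BLOCK-CHAIN (1.26)
# (`NE9RecordIneq126Chain`, NE9 leaf-05: `Σ_{Y ∋ c} e^{−κd(Y)} ≤ 2²⁰ + 1` for `κ ≥ 144`, versus `K₀(64,8) = 162⁶⁴∕81 ≈ 10^{139.5}` at
# `κ₀ = 64·log 162 ≈ 325.6`): the KP binder, R-IDENT's window binders and the END on the measurable slot with the (1.26) constant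
# `2²⁰ + 1` and the rate floor `144` in place of `K₀(64,8)` and `64·log 162`

Cell `pub-balaban`, unit `b2b-balaban-t4-ne5-p2` (NE5 ∕ U3 PROVER seat P2 «polymer-activity Lipschitz ∕ Kotecký–Preiss route», lineage gen 20).
Summits-side new work (cell bookkeeping; NOT a Literature module; nothing of the manuscripts is asserted).  HONEST FRAMING: rung (B)+1 of the
FINITE-VOLUME T⁴ programme — NOT infinite volume, NOT mass gap, NOT Clay, **NOT A PROOF OF NE5** (spine 0∕9): an implication from displayed binders
over NAMED-PARAMETER cores and constants.  HONEST DEPENDENCY (cell line, verbatim): continuum YM on T⁴ ⇐ BetaPertH ∧ nine spine estimates (0/9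
proved); BetaPertH ⇐ (D1) ∧ (D4) ∧ CAP+tail; G-an2-4 gates asym, D1 and NE2/3/4.

WHY.  The arithmetic census of route P2's END (`B13KPStepTermCensus`, this gen) makes [II] p. 21's «ε₁ sufficiently small ∕ κ sufficiently large»
an explicit pair of inequalities; with the (1.26) constant of `B13DomainGeometryTR.ineq126_level` (Dimock App. A Lemma 25 with `c₀ = 64`, `Δ = 8`:
`K₀(64,8) ≈ 10^{139.5}`, `κ₀ ≈ 325.6`) the amplitude threshold carries the factor `(9·K₀(64,8)·e^{64})⁻¹ ≈ 10^{−168.2}`.  The cell's SHARPER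
certified (1.26) on the same carriers — the block-chain count of `NE9RecordIneq126Chain.ineq126_level_chain_144` (SMALLNESS.md S-B13.24) — replaces
`K₀(64,8)` by `2²⁰ + 1 ≈ 1.05·10⁶` and `κ₀` by `144`, i.e. the factor becomes `(9·(2²⁰+1)·e^{64})⁻¹ ≈ 10^{−34.8}` and the rate room `208 + σ`
instead of `389.6 + σ`.  Nothing analytic changes; this file re-runs the same compositions BY NAME on the sharper socket.
WHAT.
* §1 `sum_anchored_le_of_majorant_chain` — twin of `B13KPStepTermWindow.sum_anchored_le_of_majorant`: a weight `n ≤ A·e^{−R_m·d}` on 𝐃_k with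
  `208 ≤ R_m` has anchored exponential norm `≤ A·e^{64}·(2²⁰ + 1)`; `kpInflated_b13_chain144` — `NE9RecordIneq126Chain.kpInflated_b13_chain` at
  `s′ = 64`: rate room `144 + σ + 64τ ≤ R_m`, smallness `(1+s)·A·e^{5σ+64τ}·(2²⁰+1)·9 ≤ τ` (tail `2⁵Γ₄³e^{−64} ≤ 1` by `socketConst_four_lt_exp`);
* §2 `window_of_majorant_chain` (any slots) — twin of `B13KPStepTermWindow.window_of_majorant`: `Σ_ℓ ‖S.act Z ℓ q‖ ≤ A_m·e^{−R_m·d(Z)}` ∧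
  `208 ≤ R_m` ∧ `36·A_m·e^{64}·(2²⁰+1) < 1` ⟹ `LevelSummable ∧ ClusAbsConv`;
* §3 **`ne5_above_max_record_measOp_chain`** ∕ **`ne5_at_max_record_measOp_chain`** — twins of `B13KPStepTermMeasurable.ne5_above_max_record_measOp`
  (p215035) and of `B13KPStepTermCensusAtRate.ne5_at_max_record_measOp` with the numeric binders `hrate : 144 + σ + 64τ ≤ R_m`,
  `hsmall : (1+s)·A_m·e^{5σ+64τ}·(2²⁰+1)·9 ≤ τ`, `hrate' : 208 ≤ R_m`, `hsmall' : 36·A_m·e^{64}·(2²⁰+1) < 1`; every other displayed binder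
  VERBATIM as in p215035 (per catalogued term `Admissible`, `GeometryCore`, `ReadLip`, measurability side conditions, `hsum`, `RefAt` ×2;
  W1∕W4∕W3 of the step of record; the holder's transport reading; (R1)–(R3), rate clause) and the same discharges (MI-R, L07, L08a∕b,
  L03-geometry, L09 ×2, the insertion structure, window binders).
NOT NE5.  0 sorry; axioms ⊆ {propext, Classical.choice, Quot.sound}.
-/

noncomputable section

open MeasureTheory
open scoped BigOperators

namespace Summit.QuantumFields.BalabanUV.T4Continuum.B13KPStepTermWindowChain

open Literature.MathematicalPhysics.QuantumFieldTheory.Balaban1983to89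
open Literature.MathematicalPhysics.QuantumFieldTheory.Balaban1983to89.T4OutputRate (Carriers Functional DecayBound NE5)
open Literature.MathematicalPhysics.QuantumFieldTheory.Balaban1983to89.T4InputCauchyRateData (StepModel)
open Literature.MathematicalPhysics.QuantumFieldTheory.Balaban1983to89.T4ActivityLipschitz (ClusterRep)
open Literature.MathematicalPhysics.QuantumFieldTheory.Balaban1983to89.T4ActivityRecursion (InputModel KPInflated)
open Summit.QuantumFields.BalabanUV.T4Continuum.ActivityTermModel (TermDatum TermConsts TermFamily)
open Summit.QuantumFields.BalabanUV.T4Continuum.B13Carriers (TwoRuns)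
open Summit.QuantumFields.BalabanUV.T4Continuum.ClusterRepOfDomains (DomainGeometry)
open Summit.QuantumFields.BalabanUV.T4Continuum.B13DomainGeometryTR (SCube domainGeometry clusterRep footprint reach loc_b13
  reach_b13 volBound_level decayExtract_b13 pinBudget_b13)
open Summit.QuantumFields.BalabanUV.T4Continuum.B13InnerData (b13InnerData Bnd)
open Summit.QuantumFields.BalabanUV.T4Continuum.B13OpDatum (OpDatum Species)
open Summit.QuantumFields.BalabanUV.T4Continuum.B13HistMeasurable (MeasPotFrame B13HistM)
open Summit.QuantumFields.BalabanUV.T4Continuum.B13StepOfRecord (Slots step outA outB assembly)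
open Summit.QuantumFields.BalabanUV.T4Continuum.B13StepTermLabels (InnerLabel innerLabels)
open Summit.QuantumFields.BalabanUV.T4Continuum.B13OutKPFormRecord (LevelSummable ClusAbsConv)
open Summit.QuantumFields.BalabanUV.T4Continuum.B13KPStepOfRecord (outA_KP outB_KP rhoA rhoB inputA_KP inputB_KP represents_kp
  ne5_above_max_record_of_kp)
open Summit.QuantumFields.BalabanUV.T4Continuum.B13TermData (TermCore termData)
open Summit.QuantumFields.BalabanUV.T4Continuum.B13StepOfRecordTermData (TermSlots)
open Summit.QuantumFields.BalabanUV.T4Continuum.B13KPStepTermWindow (levelSummable_of_actNorm clusAbsConv_of_actNorm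
  decayBoundA_of_baseMajorant outA_KP_of_not_transport)
open Summit.QuantumFields.BalabanUV.T4Continuum.B13OpMeasurable (measOp)
open Summit.QuantumFields.BalabanUV.T4Continuum.B13KPStepTermMeasurable (termFamilyM stepOnSub wellFormed_M readsStep_M realizes_M
  inBase_M actNorm_le_majorant_M structure_onSub operatorRate_onSub insertionRate_onSub insScaleBound_onSub)
open Summit.QuantumFields.BalabanUV.T4Continuum.UrsellTermBudget (actSum)
open Summit.QuantumFields.BalabanUV.T4Continuum.UrsellTreeSum (ind)
open Summit.QuantumFields.BalabanUV.T4Continuum.NE9RecordIneq126Chain (ineq126_level_chain_144 kpInflated_b13_chain)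
open Summit.QuantumFields.BalabanUV.T4Continuum.NE9TorusIneq126Chain (chainConst kappa₁ chainConst_pos)
open Summit.QuantumFields.BalabanUV.T4Continuum.NE9TorusIneq126ChainSum (kappa₁_four_lt socketConst_four_lt_exp)

variable {𝔾 : Type} [GaugeGroup 𝔾] {R : TwoRuns 𝔾}

/-! ## §1 The anchored exponential norm and the KP binder on the block-chain (1.26) -/

/-- [folklore] **ANCHORED EXPONENTIAL NORM OF A (2.38)-SHAPED WEIGHT, BLOCK-CHAIN SOCKET**: on the domain geometry of record a weight
`n ≤ A·e^{−R_m·d}` (`A ≥ 0`) on 𝐃_k with `208 ≤ R_m` has `Σ_{Z ∋ c} n(Z)·e^{#cubes Z} ≤ A·e^{64}·(2²⁰ + 1)` at every cube — (1.26) from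
`ineq126_level_chain_144` at `κ = 144`, (2.30) `volBound_level`. -/
theorem sum_anchored_le_of_majorant_chain {k : ℕ} {n : R.carriers.Dom → ℝ} {A Rm : ℝ} (hA : 0 ≤ A)
    (hn : ∀ Z ∈ (domainGeometry R).level k, n Z ≤ A * Real.exp (-(Rm * R.carriers.d Z)))
    (hrate : (208 : ℝ) ≤ Rm) (c : SCube R) :
    ∑ Z ∈ (domainGeometry R).level k, ind (c ∈ footprint Z) * n Z * Real.exp ((footprint Z).card : ℝ) ≤
      A * Real.exp 64 * (2 ^ 20 + 1) := by
  have h126 : ∑ Z ∈ ((domainGeometry R).level k).filter (fun Z => c ∈ footprint Z),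
      Real.exp (-(144 * R.carriers.d Z)) ≤ 2 ^ 20 + 1 := ineq126_level_chain_144 (R := R) k (κ := 144) le_rfl c
  have hvol : ∀ Z ∈ (domainGeometry R).level k, ((footprint Z).card : ℝ) ≤ 64 * (1 + R.carriers.d Z) :=
    fun Z hZ => volBound_level (R := R) k Z hZ
  have hAe : 0 ≤ A * Real.exp 64 := mul_nonneg hA (Real.exp_nonneg _)
  have hpt : ∀ Z ∈ (domainGeometry R).level k,
      n Z * Real.exp ((footprint Z).card : ℝ) ≤ A * Real.exp 64 * Real.exp (-(144 * R.carriers.d Z)) := by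
    intro Z hZ
    have hd := R.carriers.d_nonneg Z
    calc n Z * Real.exp ((footprint Z).card : ℝ)
        ≤ (A * Real.exp (-(Rm * R.carriers.d Z))) * Real.exp (64 * (1 + R.carriers.d Z)) :=
          mul_le_mul (hn Z hZ) (Real.exp_le_exp.2 (hvol Z hZ)) (Real.exp_nonneg _)
            (mul_nonneg hA (Real.exp_nonneg _))
      _ = A * Real.exp 64 * Real.exp (-((Rm - 64) * R.carriers.d Z)) := by
          rw [mul_assoc, ← Real.exp_add, mul_assoc, ← Real.exp_add]
          congr 2
          ring
      _ ≤ A * Real.exp 64 * Real.exp (-(144 * R.carriers.d Z)) := by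
          refine mul_le_mul_of_nonneg_left (Real.exp_le_exp.2 (neg_le_neg ?_)) hAe
          exact mul_le_mul_of_nonneg_right (by linarith) hd
  have heq : ∑ Z ∈ (domainGeometry R).level k, ind (c ∈ footprint Z) * n Z * Real.exp ((footprint Z).card : ℝ) =
      ∑ Z ∈ ((domainGeometry R).level k).filter (fun Z => c ∈ footprint Z), n Z * Real.exp ((footprint Z).card : ℝ) := by
    rw [Finset.sum_filter]
    refine Finset.sum_congr rfl fun Z _ => ?_
    unfold ind
    split_ifs <;> simp
  rw [heq]
  calc ∑ Z ∈ ((domainGeometry R).level k).filter (fun Z => c ∈ footprint Z), n Z * Real.exp ((footprint Z).card : ℝ)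
      ≤ ∑ Z ∈ ((domainGeometry R).level k).filter (fun Z => c ∈ footprint Z),
          A * Real.exp 64 * Real.exp (-(144 * R.carriers.d Z)) :=
        Finset.sum_le_sum fun Z hZ => hpt Z (Finset.mem_filter.1 hZ).1
    _ = A * Real.exp 64 * ∑ Z ∈ ((domainGeometry R).level k).filter (fun Z => c ∈ footprint Z),
          Real.exp (-(144 * R.carriers.d Z)) := by rw [Finset.mul_sum]
    _ ≤ A * Real.exp 64 * (2 ^ 20 + 1) := mul_le_mul_of_nonneg_left h126 hAe

/-- [folklore] **THE KP BINDER OF ROUTE P2 ON THE BLOCK-CHAIN SOCKET AT `s′ = 64`** (`NE9RecordIneq126Chain.kpInflated_b13_chain` BY NAME, the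
tail `2⁵Γ₄³e^{−64} ≤ 1` and `κ₁(4) < 80` folded): rate room `144 + σ + 64τ ≤ R_m`, smallness `(1+s)·A·e^{5σ+64τ}·(2²⁰+1)·9 ≤ τ`. -/
theorem kpInflated_b13_chain144 (ρA ρB : (ℕ → ℝ) → R.carriers.BgB → R.carriers.Dom → ℂ) {W : Set (ℕ → ℝ)}
    {m : (ℕ → ℝ) → R.carriers.BgB → R.carriers.Dom → ℝ} {A Rm τ σ s : ℝ}
    (hA : 0 ≤ A) (hτ : 0 ≤ τ) (hσ : 0 ≤ σ) (hs : 0 ≤ s)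
    (hm0 : ∀ g U Z, 0 ≤ m g U Z)
    (hm : ∀ g ∈ W, ∀ U (k : ℕ), ∀ Z ∈ R.domAt k, m g U Z ≤ A * Real.exp (-(Rm * R.carriers.d Z)))
    (hrate : 144 + σ + τ * 64 ≤ Rm)
    (hsmall : (1 + s) * A * Real.exp (σ * 5 + τ * 64) * (2 ^ 20 + 1) * 9 ≤ τ) :
    KPInflated (clusterRep R ρA ρB) W m s (fun Z => τ * ((footprint Z).card : ℝ))
      (fun Z => σ * R.carriers.d Z + σ * 5) := by
  have hk := kappa₁_four_lt
  have htail : (2 : ℝ) ^ 5 * chainConst 4 ^ 3 * Real.exp (-64) ≤ 1 := by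
    have h2 := socketConst_four_lt_exp
    have h3 : (0 : ℝ) ≤ 2 ^ 5 * chainConst 4 ^ 3 := by
      have := chainConst_pos 4
      positivity
    have h5 : (2 : ℝ) ^ (4 + 1) = 2 ^ 5 := by norm_num
    rw [h5] at h2
    calc (2 : ℝ) ^ 5 * chainConst 4 ^ 3 * Real.exp (-64)
        ≤ Real.exp 64 * Real.exp (-64) := mul_le_mul_of_nonneg_right h2.le (Real.exp_pos _).le
      _ = 1 := by rw [← Real.exp_add]; norm_num
  have hpre : 0 ≤ (1 + s) * A * Real.exp (σ * 5 + τ * 64) := by positivity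
  refine kpInflated_b13_chain R ρA ρB hA hτ hσ hs (s' := 64) (by norm_num) hm0 hm (by linarith) ?_
  calc (1 + s) * A * Real.exp (σ * 5 + τ * 64) * (2 ^ 20 + 2 ^ 5 * chainConst 4 ^ 3 * Real.exp (-64)) * 9
      ≤ (1 + s) * A * Real.exp (σ * 5 + τ * 64) * (2 ^ 20 + 1) * 9 := by
        have : (2 : ℝ) ^ 20 + 2 ^ 5 * chainConst 4 ^ 3 * Real.exp (-64) ≤ 2 ^ 20 + 1 := by linarith
        exact mul_le_mul_of_nonneg_right (mul_le_mul_of_nonneg_left this hpre) (by norm_num)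
    _ ≤ τ := hsmall

/-! ## §2 The two window binders of the model of record at an input point, block-chain socket, any slots -/

section AnySlots

variable {E IOp Hist : Type*} [NormedAddCommGroup Hist] [NormedSpace ℂ Hist] (S : Slots R E IOp Hist)

/-- [folklore] **BOTH WINDOW BINDERS FROM A (2.38)-SHAPED MAJORANT OF THE ACTIVITIES AT THE INPUT POINT, BLOCK-CHAIN SOCKET**:
`Σ_ℓ ‖S.act Z ℓ q‖ ≤ A_m·e^{−R_m·d(Z)}` on 𝐃_{scale X}, `208 ≤ R_m`, `36·A_m·e^{64}·(2²⁰+1) < 1` ⟹ `LevelSummable S X q ∧ ClusAbsConv S X q`. -/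
theorem window_of_majorant_chain {X : R.carriers.Dom} {q : OpDatum E × Hist} {A_m R_m : ℝ} (hA_m : 0 ≤ A_m)
    (hn : ∀ Z ∈ (domainGeometry R).level (R.carriers.scale X),
      ∑ ℓ ∈ innerLabels (b13InnerData R) (R.carriers.scale X) Z, ‖S.act Z ℓ q.1 q.2‖ ≤ A_m * Real.exp (-(R_m * R.carriers.d Z)))
    (hrate' : (208 : ℝ) ≤ R_m) (hsmall' : 36 * (A_m * Real.exp 64 * (2 ^ 20 + 1)) < 1) :
    LevelSummable S X q ∧ ClusAbsConv S X q := by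
  have hA : ∀ (Z : R.carriers.Dom) (ℓ : InnerLabel R.carriers.Dom (Bnd R)), 0 ≤ ‖S.act Z ℓ q.1 q.2‖ := fun _ _ => norm_nonneg _
  have hact : ∀ Z ∈ (domainGeometry R).level (R.carriers.scale X), ∀ ℓ ∈ innerLabels (b13InnerData R) (R.carriers.scale X) Z,
      ‖S.act Z ℓ q.1 q.2‖ ≤ (fun Z ℓ => ‖S.act Z ℓ q.1 q.2‖) Z ℓ := fun _ _ _ _ => le_rfl
  have hΦ0 : 0 ≤ A_m * Real.exp 64 * (2 ^ 20 + 1) := by positivity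
  have hΦ := sum_anchored_le_of_majorant_chain (R := R) (k := R.carriers.scale X)
    (n := fun Z => actSum (b13InnerData R) (fun Z ℓ => ‖S.act Z ℓ q.1 q.2‖) (R.carriers.scale X) Z) hA_m
    (fun Z hZ => hn Z hZ) hrate'
  exact ⟨levelSummable_of_actNorm S hA hΦ0 hsmall' hΦ hact, clusAbsConv_of_actNorm S hA hΦ0 hsmall' hΦ hact⟩

end AnySlots

/-! ## §3 Route P2's END on the measurable slot, block-chain socket -/

variable {P : MeasPotFrame R.carriers} {𝒴 : Type*} {dom : 𝒴 → R.carriers.Dom}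
  {T κ ι S Ω Ω₀ 𝒞 IOp : Type*} [MeasurableSpace Ω] [MeasurableSpace Ω₀] [Fintype ι] [Fintype κ] [DecidableEq ι] [DecidableEq κ]
  (𝔖 : TermSlots R P dom T κ ι S Ω Ω₀ 𝒞 IOp) (E₀ cB : ℝ)
  (hA : ∀ g U k, (step 𝔖.toSlots E₀ cB).opA g U k ∈ measOp T κ ι Ω 𝒴)
  (hB : ∀ g U k, (step 𝔖.toSlots E₀ cB).opB g U k ∈ measOp T κ ι Ω 𝒴)
  (𝔡 : R.carriers.Dom → InnerLabel R.carriers.Dom (Bnd R) → TermConsts)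

variable [DecidableEq 𝒞]

/-- [folklore] **ROUTE P2's END ON BAŁABAN's CARRIERS OF RECORD, MEASURABLE SLOT, BLOCK-CHAIN SOCKET, at every rate above `max(θ, r_fb)`** —
the twin of `B13KPStepTermMeasurable.ne5_above_max_record_measOp` (p215035) with the KP binder from `kpInflated_b13_chain144` and the window binders
from `window_of_majorant_chain`: the numeric binders read `hrate : 144 + σ + 64τ ≤ R_m`, `hsmall : (1+s)·A_m·e^{5σ+64τ}·(2²⁰+1)·9 ≤ τ`,
`hrate' : 208 ≤ R_m`, `hsmall' : 36·A_m·e^{64}·(2²⁰+1) < 1`; every other displayed binder verbatim as in p215035, same discharges.  NOT a proof of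
NE5; cores and constants are NAMED PARAMETERS. -/
theorem ne5_above_max_record_measOp_chain (hT : (assembly 𝔖.toSlots).TransportReads Set.univ) {W : Set (ℕ → ℝ)}
    {m : (ℕ → ℝ) → R.carriers.BgB → R.carriers.Dom → ℝ}
    {A_m R_m τ σ s E₁ ϰ θ δ δ' c ω Λop Λhist ρ₀ ρ₀' : ℝ}
    (hA_m : 0 ≤ A_m) (hτ : 0 ≤ τ) (hσ : 0 ≤ σ) (hs0 : 0 ≤ s)
    (hm0 : ∀ (g : ℕ → ℝ) (U : R.carriers.BgB) (Z : R.carriers.Dom), 0 ≤ m g U Z)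
    (hm : ∀ g ∈ W, ∀ (U : R.carriers.BgB) (k : ℕ), ∀ Z ∈ R.domAt k, m g U Z ≤ A_m * Real.exp (-(R_m * R.carriers.d Z)))
    (hrate : 144 + σ + τ * 64 ≤ R_m)
    (hsmall : (1 + s) * A_m * Real.exp (σ * 5 + τ * 64) * (2 ^ 20 + 1) * 9 ≤ τ) (hσκ : ϰ + 1 ≤ σ)
    (hrate' : (208 : ℝ) ≤ R_m) (hsmall' : 36 * (A_m * Real.exp 64 * (2 ^ 20 + 1)) < 1)
    (hadm : ∀ k, ∀ Z ∈ (domainGeometry R).level k, ∀ ℓ ∈ innerLabels (b13InnerData R) k Z, (𝔡 Z ℓ).Admissible)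
    (hcore : ∀ k, ∀ Z ∈ (domainGeometry R).level k, ∀ ℓ ∈ innerLabels (b13InnerData R) k Z,
      (termData 𝔖.F 𝔖.G 𝔖.rHist 𝔖.core Z ℓ).GeometryCore (𝔡 Z ℓ))
    (hlip : ∀ k, ∀ Z ∈ (domainGeometry R).level k, ∀ ℓ ∈ innerLabels (b13InnerData R) k Z,
      (termData 𝔖.F 𝔖.G 𝔖.rHist 𝔖.core Z ℓ).ReadLip (𝔡 Z ℓ) (𝔖.rOp (R.carriers.scale Z)) (𝔖.rHist (R.carriers.scale Z)))
    (hXf : ∀ Z ℓ i, Measurable fun x => (𝔖.core Z ℓ).Xf x i) (hBf : ∀ Z ℓ a, Measurable fun x => (𝔖.core Z ℓ).Bf x a)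
    (hFQ : ∀ k (Y : 𝒴) (b b' : κ), Measurable fun x : Ω => (𝔖.F k).wt (.potQ x Y b b'))
    (hFR : ∀ k (Y : 𝒴), Measurable fun x : Ω => (𝔖.F k).wt (.potR x Y))
    (hsum : ∀ g ∈ W, ∀ (U : R.carriers.BgB) (X : R.carriers.Dom), ∀ Z ∈ (domainGeometry R).level (R.carriers.scale X),
      ∑ ℓ ∈ innerLabels (b13InnerData R) (R.carriers.scale X) Z, (termFamilyM 𝔖 E₀ cB hA hB 𝔡).G Λop Λhist ρ₀ g U X Z ℓ ≤ m g U Z)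
    (hρ₁ : ρ₀ ≤ 1)
    (hRef : ∀ g ∈ W, ∀ (U : R.carriers.BgB) (X : R.carriers.Dom),
      ∀ Z ∈ (domainGeometry R).level (R.carriers.scale X), ∀ ℓ ∈ innerLabels (b13InnerData R) (R.carriers.scale X) Z,
        (termData 𝔖.F 𝔖.G 𝔖.rHist 𝔖.core Z ℓ).RefAt (𝔡 Z ℓ) (inputB_KP 𝔖.toSlots E₀ cB g U X))
    (hRefA : ∀ g ∈ W, ∀ (U : R.carriers.BgB) (X : R.carriers.Dom),
      ∀ Z ∈ (domainGeometry R).level (R.carriers.scale X), ∀ ℓ ∈ innerLabels (b13InnerData R) (R.carriers.scale X) Z,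
        (termData 𝔖.F 𝔖.G 𝔖.rHist 𝔖.core Z ℓ).RefAt (𝔡 Z ℓ) (inputA_KP 𝔖.toSlots E₀ cB g U X))
    (hop : (step 𝔖.toSlots E₀ cB).OperatorRate W δ θ)
    (hins : (step 𝔖.toSlots E₀ cB).InsertionRate W ϰ (τ * 64 * Real.exp (-(σ * 5))) δ' θ)
    (hunit : (step 𝔖.toSlots E₀ cB).InsScaleBound W ϰ E₁ c ω)
    (hE₁ : 0 < E₁) (hΛop : 0 < Λop) (hΛhist : 0 < Λhist) (hρ : max (Λhist / Λop) 1 * ρ₀' ≤ ρ₀)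
    (hs : Λhist * ρ₀' < s) (hδ : 0 ≤ δ) (hδ' : 0 ≤ δ') (hθ : 0 ≤ θ) (hθ1 : θ < 1)
    (hc : 0 ≤ c) (hω : 0 < ω) (hω1 : ω < 1)
    (hreach : c * (τ * 64 * Real.exp (-(σ * 5)) + τ * 64 * Real.exp (-(σ * 5))) / (1 - ω) < ρ₀')
    {θ' : ℝ} (hθ' : max θ (ω + (τ * 64 * Real.exp (-(σ * 5))) * Λhist / (s - Λhist * ρ₀') * c) < θ') :
    ∃ C₅, NE5 (outA 𝔖.toSlots E₀ cB) (outB 𝔖.toSlots E₀ cB) W ϰ θ' C₅ := by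
  have hwf := wellFormed_M 𝔖 E₀ cB hA hB 𝔡 W hadm hcore hlip hXf hBf hFQ hFR
  have hrep := represents_kp 𝔖.toSlots E₀ cB hT
  have hreal := realizes_M 𝔖 E₀ cB hA hB 𝔡 W
  have hbase := inBase_M 𝔖 E₀ cB hA hB 𝔡 hRef
  have hmaj := (termFamilyM 𝔖 E₀ cB hA hB 𝔡).baseMajorant_model hwf hΛop hΛhist hsum
  have hKP := kpInflated_b13_chain144 (rhoA 𝔖.toSlots E₀ cB) (rhoB 𝔖.toSlots E₀ cB) hA_m hτ hσ hs0 hm0 hm hrate hsmall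
  have hdec := decayExtract_b13 (rhoA 𝔖.toSlots E₀ cB) (rhoB 𝔖.toSlots E₀ cB) hσ
  have hpin := pinBudget_b13 (rhoA 𝔖.toSlots E₀ cB) (rhoB 𝔖.toSlots E₀ cB) hτ hσκ
  have hdB : DecayBound (outB_KP 𝔖.toSlots E₀ cB) W (τ * 64 * Real.exp (-(σ * 5))) ϰ :=
    (termFamilyM 𝔖 E₀ cB hA hB 𝔡).model.decayBound_of_baseMajorant hrep hreal hbase hmaj hKP hs0 hdec hpin
  have hdA : DecayBound (outA_KP 𝔖.toSlots E₀ cB) W (τ * 64 * Real.exp (-(σ * 5))) ϰ :=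
    decayBoundA_of_baseMajorant (termFamilyM 𝔖 E₀ cB hA hB 𝔡).model hrep hreal (fun g hg U X Z hZ ℓ hℓ =>
      (termData 𝔖.F 𝔖.G 𝔖.rHist 𝔖.core Z ℓ).refAt_onSub (measOp T κ ι Ω 𝒴) (hRefA g hg U X Z hZ ℓ hℓ)) hmaj hKP hs0 hdec hpin
      (by positivity) fun g _ V hV X => outA_KP_of_not_transport 𝔖.toSlots E₀ cB hV X
  have hwinA : ∀ g ∈ W, ∀ (U : R.carriers.BgB) (X : R.carriers.Dom),
      LevelSummable 𝔖.toSlots X (inputA_KP 𝔖.toSlots E₀ cB g U X) ∧ ClusAbsConv 𝔖.toSlots X (inputA_KP 𝔖.toSlots E₀ cB g U X) :=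
    fun g hg U X => window_of_majorant_chain 𝔖.toSlots hA_m
      (actNorm_le_majorant_M 𝔖 E₀ cB hA hB 𝔡 hΛop hΛhist hadm hsum hm hg U X (hRefA g hg U X)) hrate' hsmall'
  have hwinB : ∀ g ∈ W, ∀ (U : R.carriers.BgB) (X : R.carriers.Dom),
      LevelSummable 𝔖.toSlots X (inputB_KP 𝔖.toSlots E₀ cB g U X) ∧ ClusAbsConv 𝔖.toSlots X (inputB_KP 𝔖.toSlots E₀ cB g U X) :=
    fun g hg U X => window_of_majorant_chain 𝔖.toSlots hA_m
      (actNorm_le_majorant_M 𝔖 E₀ cB hA hB 𝔡 hΛop hΛhist hadm hsum hm hg U X (hRef g hg U X)) hrate' hsmall'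
  obtain ⟨haffN, hblindN, hhomN⟩ := structure_onSub 𝔖 E₀ cB hA hB W
  refine ne5_above_max_record_of_kp 𝔖.toSlots E₀ cB hT (fun g hg U X => (hwinA g hg U X).1) (fun g hg U X => (hwinA g hg U X).2)
    (fun g hg U X => (hwinB g hg U X).1) (fun g hg U X => (hwinB g hg U X).2) ?_
  exact ActivityStepJunction.TermFamily.ne5_above_max_of_model_reach_step (termFamilyM 𝔖 E₀ cB hA hB 𝔡)
    (readsStep_M 𝔖 E₀ cB hA hB 𝔡) hwf hsum hρ₁ hrep hreal hbase hKP hdec hpin hdA hdB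
    (operatorRate_onSub 𝔖 E₀ cB hA hB hop) (insertionRate_onSub 𝔖 E₀ cB hA hB hins) haffN hblindN hhomN
    (insScaleBound_onSub 𝔖 E₀ cB hA hB hunit) hE₁ (by positivity) hΛop hΛhist hρ hs hδ hδ' hθ hθ1 hc hω hω1 hreach hθ'

/-- [folklore] **… AND AT THE THRESHOLD `max(θ, r_fb)` OFF RESONANCE, BLOCK-CHAIN SOCKET** (the twin of
`B13KPStepTermCensusAtRate.ne5_at_max_record_measOp`; K7's `TermFamily.ne5_at_max_of_model_reach_step`).  NOT a proof of NE5. -/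
theorem ne5_at_max_record_measOp_chain (hT : (assembly 𝔖.toSlots).TransportReads Set.univ) {W : Set (ℕ → ℝ)}
    {m : (ℕ → ℝ) → R.carriers.BgB → R.carriers.Dom → ℝ}
    {A_m R_m τ σ s E₁ ϰ θ δ δ' c ω Λop Λhist ρ₀ ρ₀' : ℝ}
    (hA_m : 0 ≤ A_m) (hτ : 0 ≤ τ) (hσ : 0 ≤ σ) (hs0 : 0 ≤ s)
    (hm0 : ∀ (g : ℕ → ℝ) (U : R.carriers.BgB) (Z : R.carriers.Dom), 0 ≤ m g U Z)
    (hm : ∀ g ∈ W, ∀ (U : R.carriers.BgB) (k : ℕ), ∀ Z ∈ R.domAt k, m g U Z ≤ A_m * Real.exp (-(R_m * R.carriers.d Z)))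
    (hrate : 144 + σ + τ * 64 ≤ R_m)
    (hsmall : (1 + s) * A_m * Real.exp (σ * 5 + τ * 64) * (2 ^ 20 + 1) * 9 ≤ τ) (hσκ : ϰ + 1 ≤ σ)
    (hrate' : (208 : ℝ) ≤ R_m) (hsmall' : 36 * (A_m * Real.exp 64 * (2 ^ 20 + 1)) < 1)
    (hadm : ∀ k, ∀ Z ∈ (domainGeometry R).level k, ∀ ℓ ∈ innerLabels (b13InnerData R) k Z, (𝔡 Z ℓ).Admissible)
    (hcore : ∀ k, ∀ Z ∈ (domainGeometry R).level k, ∀ ℓ ∈ innerLabels (b13InnerData R) k Z,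
      (termData 𝔖.F 𝔖.G 𝔖.rHist 𝔖.core Z ℓ).GeometryCore (𝔡 Z ℓ))
    (hlip : ∀ k, ∀ Z ∈ (domainGeometry R).level k, ∀ ℓ ∈ innerLabels (b13InnerData R) k Z,
      (termData 𝔖.F 𝔖.G 𝔖.rHist 𝔖.core Z ℓ).ReadLip (𝔡 Z ℓ) (𝔖.rOp (R.carriers.scale Z)) (𝔖.rHist (R.carriers.scale Z)))
    (hXf : ∀ Z ℓ i, Measurable fun x => (𝔖.core Z ℓ).Xf x i) (hBf : ∀ Z ℓ a, Measurable fun x => (𝔖.core Z ℓ).Bf x a)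
    (hFQ : ∀ k (Y : 𝒴) (b b' : κ), Measurable fun x : Ω => (𝔖.F k).wt (.potQ x Y b b'))
    (hFR : ∀ k (Y : 𝒴), Measurable fun x : Ω => (𝔖.F k).wt (.potR x Y))
    (hsum : ∀ g ∈ W, ∀ (U : R.carriers.BgB) (X : R.carriers.Dom), ∀ Z ∈ (domainGeometry R).level (R.carriers.scale X),
      ∑ ℓ ∈ innerLabels (b13InnerData R) (R.carriers.scale X) Z, (termFamilyM 𝔖 E₀ cB hA hB 𝔡).G Λop Λhist ρ₀ g U X Z ℓ ≤ m g U Z)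
    (hρ₁ : ρ₀ ≤ 1)
    (hRef : ∀ g ∈ W, ∀ (U : R.carriers.BgB) (X : R.carriers.Dom),
      ∀ Z ∈ (domainGeometry R).level (R.carriers.scale X), ∀ ℓ ∈ innerLabels (b13InnerData R) (R.carriers.scale X) Z,
        (termData 𝔖.F 𝔖.G 𝔖.rHist 𝔖.core Z ℓ).RefAt (𝔡 Z ℓ) (inputB_KP 𝔖.toSlots E₀ cB g U X))
    (hRefA : ∀ g ∈ W, ∀ (U : R.carriers.BgB) (X : R.carriers.Dom),
      ∀ Z ∈ (domainGeometry R).level (R.carriers.scale X), ∀ ℓ ∈ innerLabels (b13InnerData R) (R.carriers.scale X) Z,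
        (termData 𝔖.F 𝔖.G 𝔖.rHist 𝔖.core Z ℓ).RefAt (𝔡 Z ℓ) (inputA_KP 𝔖.toSlots E₀ cB g U X))
    (hop : (step 𝔖.toSlots E₀ cB).OperatorRate W δ θ)
    (hins : (step 𝔖.toSlots E₀ cB).InsertionRate W ϰ (τ * 64 * Real.exp (-(σ * 5))) δ' θ)
    (hunit : (step 𝔖.toSlots E₀ cB).InsScaleBound W ϰ E₁ c ω)
    (hE₁ : 0 < E₁) (hΛop : 0 < Λop) (hΛhist : 0 < Λhist) (hρ : max (Λhist / Λop) 1 * ρ₀' ≤ ρ₀)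
    (hs : Λhist * ρ₀' < s) (hδ : 0 ≤ δ) (hδ' : 0 ≤ δ') (hθ : 0 ≤ θ) (hθ1 : θ < 1)
    (hc : 0 ≤ c) (hω : 0 < ω) (hω1 : ω < 1)
    (hreach : c * (τ * 64 * Real.exp (-(σ * 5)) + τ * 64 * Real.exp (-(σ * 5))) / (1 - ω) < ρ₀')
    (hres : θ ≠ ω + (τ * 64 * Real.exp (-(σ * 5))) * Λhist / (s - Λhist * ρ₀') * c) :
    ∃ C₅, NE5 (outA 𝔖.toSlots E₀ cB) (outB 𝔖.toSlots E₀ cB) W ϰ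
      (max θ (ω + (τ * 64 * Real.exp (-(σ * 5))) * Λhist / (s - Λhist * ρ₀') * c)) C₅ := by
  have hwf := wellFormed_M 𝔖 E₀ cB hA hB 𝔡 W hadm hcore hlip hXf hBf hFQ hFR
  have hrep := represents_kp 𝔖.toSlots E₀ cB hT
  have hreal := realizes_M 𝔖 E₀ cB hA hB 𝔡 W
  have hbase := inBase_M 𝔖 E₀ cB hA hB 𝔡 hRef
  have hmaj := (termFamilyM 𝔖 E₀ cB hA hB 𝔡).baseMajorant_model hwf hΛop hΛhist hsum
  have hKP := kpInflated_b13_chain144 (rhoA 𝔖.toSlots E₀ cB) (rhoB 𝔖.toSlots E₀ cB) hA_m hτ hσ hs0 hm0 hm hrate hsmall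
  have hdec := decayExtract_b13 (rhoA 𝔖.toSlots E₀ cB) (rhoB 𝔖.toSlots E₀ cB) hσ
  have hpin := pinBudget_b13 (rhoA 𝔖.toSlots E₀ cB) (rhoB 𝔖.toSlots E₀ cB) hτ hσκ
  have hdB : DecayBound (outB_KP 𝔖.toSlots E₀ cB) W (τ * 64 * Real.exp (-(σ * 5))) ϰ :=
    (termFamilyM 𝔖 E₀ cB hA hB 𝔡).model.decayBound_of_baseMajorant hrep hreal hbase hmaj hKP hs0 hdec hpin
  have hdA : DecayBound (outA_KP 𝔖.toSlots E₀ cB) W (τ * 64 * Real.exp (-(σ * 5))) ϰ :=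
    decayBoundA_of_baseMajorant (termFamilyM 𝔖 E₀ cB hA hB 𝔡).model hrep hreal (fun g hg U X Z hZ ℓ hℓ =>
      (termData 𝔖.F 𝔖.G 𝔖.rHist 𝔖.core Z ℓ).refAt_onSub (measOp T κ ι Ω 𝒴) (hRefA g hg U X Z hZ ℓ hℓ)) hmaj hKP hs0 hdec hpin
      (by positivity) fun g _ V hV X => outA_KP_of_not_transport 𝔖.toSlots E₀ cB hV X
  have hwinA : ∀ g ∈ W, ∀ (U : R.carriers.BgB) (X : R.carriers.Dom),
      LevelSummable 𝔖.toSlots X (inputA_KP 𝔖.toSlots E₀ cB g U X) ∧ ClusAbsConv 𝔖.toSlots X (inputA_KP 𝔖.toSlots E₀ cB g U X) :=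
    fun g hg U X => window_of_majorant_chain 𝔖.toSlots hA_m
      (actNorm_le_majorant_M 𝔖 E₀ cB hA hB 𝔡 hΛop hΛhist hadm hsum hm hg U X (hRefA g hg U X)) hrate' hsmall'
  have hwinB : ∀ g ∈ W, ∀ (U : R.carriers.BgB) (X : R.carriers.Dom),
      LevelSummable 𝔖.toSlots X (inputB_KP 𝔖.toSlots E₀ cB g U X) ∧ ClusAbsConv 𝔖.toSlots X (inputB_KP 𝔖.toSlots E₀ cB g U X) :=
    fun g hg U X => window_of_majorant_chain 𝔖.toSlots hA_m
      (actNorm_le_majorant_M 𝔖 E₀ cB hA hB 𝔡 hΛop hΛhist hadm hsum hm hg U X (hRef g hg U X)) hrate' hsmall'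
  obtain ⟨haffN, hblindN, hhomN⟩ := structure_onSub 𝔖 E₀ cB hA hB W
  refine ne5_above_max_record_of_kp 𝔖.toSlots E₀ cB hT (fun g hg U X => (hwinA g hg U X).1) (fun g hg U X => (hwinA g hg U X).2)
    (fun g hg U X => (hwinB g hg U X).1) (fun g hg U X => (hwinB g hg U X).2) ?_
  exact ActivityStepJunction.TermFamily.ne5_at_max_of_model_reach_step (termFamilyM 𝔖 E₀ cB hA hB 𝔡)
    (readsStep_M 𝔖 E₀ cB hA hB 𝔡) hwf hsum hρ₁ hrep hreal hbase hKP hdec hpin hdA hdB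
    (operatorRate_onSub 𝔖 E₀ cB hA hB hop) (insertionRate_onSub 𝔖 E₀ cB hA hB hins) haffN hblindN hhomN
    (insScaleBound_onSub 𝔖 E₀ cB hA hB hunit) hE₁ (by positivity) hΛop hΛhist hρ hs hδ hδ' hθ hθ1 hc hω hω1 hreach hres

end Summit.QuantumFields.BalabanUV.T4Continuum.B13KPStepTermWindowChain

end
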